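import Summits.SmoothPoincare4.SmoothPoincare4.Theorems.SullivanDualTargetOfSympcap
import Literature.Geometry.Symplectic.JHolomorphicOn

/-!
# Line `last-twisted-circle` — skeleton for crux `SullivanDual.Target` (stmt-SmoothPoincare4-7823)

(route route-SmoothPoincare4-SullivanDual, rank 0 deciding crux; card
`Cruxes/Target/Ideas/last-twisted-circle.md`, MERGED by the triage panel with
`taubes-circle-cancellation` — same lever — with the direction "fold taubes INTO last-twisted-circle"
(TRIAGE-r1-1: pass ×4, merge; r1-2: pass/pass/pass/fail, merge; r1-3: deciding panelist, same);
constraint file `Cruxes/Target/NEGATIVE-local-cancellation-is-dead.md`.)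

Crux (fixed, never restated): `Target` — for every homotopy 4-sphere `Σ` and `p ∈ Σ` some smooth `J`
with `J² = −1` on `Σ ∖ p` has, for all small radii, no taming witness (W1)–(W3).  The line enters
through DOOR 3, the landed `SullivanDual.target_of_sympcapThesisV2` (Theorems/SullivanDualTargetOfSympcap,
p119400): a smooth closed non-degenerate `2`-form standard on a punctured chart-ball
(`IsSymplecticStandardNearPoint p ε sf`) on every `Σ ∖ p` gives `Target` (the `sf`-compatible `J` and the
two-line kill `noWitness_of_closed_standard_tames`).

## The line: start from an asymptotically standard NEAR-SYMPLECTIC form (it exists on every `Σ ∖ p`),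
## normalise its zero set to two UNTWISTED Taubes-model circles, take the Seiberg–Witten-forced spanning
## curve, SELECT a geometrically unique spanning cylinder (the SPC4-carrier), and CANCEL the pair
## along it rel the standard end (Taubes' 1998 programme with the global hypothesis made explicit).

The card's own dial — `Target ⟺` "some asymptotically flat conformal class has a zero-free harmonic
self-dual representative" — is, at the level of the crux statement, exactly door (a)/(3) and its landed
converse (`target_iff_sympcapThesisV2`, `exists_tamedJ_of_nondegenerate`): the conformal class is the
heuristic that picks the form, the removal of its zero circles is the whole formal content, so the
skeleton is the removal chain the panel prescribed (TRIAGE-r1-3 §last-twisted-circle "sharpen";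
NEGATIVE note §Consequence): NSExist → GerigCurve → APEX [global uniqueness ⇒ removal rel end] → door.

Data flow of the five registered stubs (all radii explicit; `E4 = ℝ⁴`; the two tubes are indexed by
`φ : Fin 2 → E4 → Σ∖p`; no local definition occurs in a signature, so a stub worker restates each
signature verbatim in a `Theorems/` file importing only the route and `JHolomorphicOn`):

* `stub_nearSymplecticNormalForm` (L/XL formal; TRUE for all `Σ`): `ε, δ, ω, φ` — `ω` smooth closed,
  standard on the punctured `ε`-ball, equal to Taubes' model `ω_T` in two disjoint tube charts of the
  solid torus `T_δ ⊂ ℝ⁴`, non-degenerate off the two core circles (two UNTWISTED zero circles).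
* `stub_spanningHalfCylinders` (XL; TRUE for all `Σ`, Gerig MR2): an admissible `J` (tame off `Z`,
  standard near `p`, Taubes' model `J_T` in the tubes) and, at each circle, a finite-energy
  `J`-holomorphic punctured plane with a degree-one end on it.
* `stub_cylinderSelection` (APEX A, XL/open, the SPC4-carrier, HARDEST): improve to data whose spanning
  cylinder is geometrically UNIQUE among finite-energy punctured planes incident to either circle.
* `stub_endConfinement` (L, provable now): maximum principle at the standard end for `J`-holomorphic
  punctured planes whose ends are elsewhere.
* `stub_cancellation` (APEX B, XL/open since 1998): a globally unique spanning cylinder cancels the pair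
  rel the standard end: `∃ ε' sf, IsSymplecticStandardNearPoint p ε' sf`.
* `Target_of` (PROVED, no `sorry` of its own): the five stubs BY NAME compose to the route decl.

Inline conventions (ℝ⁴ ∋ y = (y₀,y₁,y₂,y₃)): model solid torus
`T_δ = {(√(y₀²+y₁²) − 1)² + y₂² + y₃² < δ²}`, core circle `{y₀²+y₁² = 1, y₂ = y₃ = 0}`; toroidal
coframe `dt(a) = (y₀a₁ − y₁a₀)/(y₀²+y₁²)`, `dx(a) = (y₀a₀ + y₁a₁)/√(y₀²+y₁²)`, `dy = dy₂`, `dz = dy₃`,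
normal coordinate `x = √(y₀²+y₁²) − 1`; Taubes' form (GT 2 (1998) eq. (1.1))
`ω_T = dt∧(x dx + y dy − 2z dz) + x dy∧dz − y dx∧dz − 2z dx∧dy` (closed; `ω_T² = 2(x²+y²+4z²) dt dx dy dz`;
zero set = the core; lone eigen-axis `∂_z` constant ⇒ UNTWISTED); flat product metric
`g_T = dt² + dx² + dy² + dz²`; Taubes' structure `J_T` (eq. (1.4)) pinned implicitly by
`ω_T(a, J_T b) = √(x²+y²+4z²) g_T(a, b)` (the `(ω_T, g_T)`-compatible structure, taming sign
`ω(v, Jv) > 0` as in the route).  "Standard near `p`" for `J` is the clause of `HyperbolicEnd`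
(`⟪Dι De (J v), b⟫ = ω₀(Dι De v, b)`), for `ω` it is `IsStandardOnBall`.  A degree-`σ` END of
`u : ℂ → Σ∖p` on the circle of tube `φ i` at the puncture `0` (resp. `∞`): near the puncture `u = φ i ∘ û`
with `û` in `T_δ`, tube-radius² `(√(û₀²+û₁²) − 1)² + û₂² + û₃² → 0`, and for every ray the core angle
`(û₀, û₁)/‖·‖ → (cos(σθ + c), sin(σθ + c))` radially.  FINITE ENERGY: `z ↦ ω(u z)(du 1, du i)` is
Lebesgue-integrable on `ℂ`.

## Disproof.lean / negatives honoured (read 2026-08-16T21Z)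

* No `Disproof.lean` exists for this crux (payload path absent; `ledger crux ls stmt-SmoothPoincare4-7823`
  lists none); `ledger negatives --problem SmoothPoincare4` = 0 — nothing to import in the scratch check.
* `NEGATIVE-local-cancellation-is-dead.md` (triage r1-2/r1-3): no stub has the shape "model cylinder +
  germ normal form ⇒ symplectic replacement near it"; `stub_cancellation` carries the GLOBAL uniqueness
  hypothesis over all finite-energy punctured planes incident to `Z₁`/`Z₂` (every degree) and concludes a
  global form, rel the end only; on `S¹ × M_{5₂}` the hypothesis fails (Novikov count `2 − 3t + 2t²`).
* `Lines/Sketch-dead.md`: no stub restates item 0518 / `WeakTame` / `Target`; the crux-equivalent content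
  is split into Selection (existence of a uniquely spanned configuration — a statement about `J`-curve
  moduli, with a model computation as falsifier) and Cancellation (a universally quantified lemma).
* OrigamiFoldExistence TRIAGE-r1-2 control (`X = ℂP² # (S²×S²)/ℤ₂` proves-too-much): the `π₁`-door of
  this line is the spin-c sum in Gerig's relative Seiberg–Witten count (docstring of Stub 3).
-/

noncomputable section

-- the prescribed namespace `Summit.<P>.<Sub>.…` duplicates `SmoothPoincare4` (P = Sub)
set_option linter.dupNamespace false

open scoped Manifold ContDiff Topology
open Set Filter MeasureTheory Literature.Geometry.Kaehler Literature.Geometry.Symplectic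
  Literature.Topology.FourManifolds

namespace Summit.SmoothPoincare4.SmoothPoincare4.Cruxes.Target.LastTwistedCircle

/-- Model space `ℝ⁴` (coordinates `y₀,y₁` = the plane of the core circle, `y₂,y₃` = the other two
normal coordinates of the model solid torus). -/
local notation "E4" => EuclideanSpace ℝ (Fin 4)

/-! ## Registered stubs -/

/-- **Stub 1 — `NSExist`: an asymptotically standard near-symplectic form whose zero set is two
UNTWISTED MODEL circles (L mathematically / XL formally; TRUE for every `Σ`, in print modulo
bookkeeping).**  For every homotopy 4-sphere `Σ` and `p ∈ Σ` there are `ε > 0` (closed chart-ball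
inside the chart target), `0 < δ < 1`, a smooth CLOSED `2`-form `ω` on `Σ ∖ p` which is STANDARD
(`= ι*ω₀` through the chart at `p`, `IsStandardOnBall`) on the punctured `ε`-chart-ball, and two
tube charts `φ 0, φ 1 : T_δ → Σ ∖ p` (smooth injective immersions of the open solid torus
`T_δ = {(√(y₀²+y₁²) − 1)² + y₂² + y₃² < δ²} ⊂ ℝ⁴`, disjoint images, off the `ε`-ball) in which `ω`
IS Taubes' model `ω_T = dt∧(x dx + y dy − 2z dz) + x dy∧dz − y dx∧dz − 2z dx∧dy`
(`t` = angle of `(y₀, y₁)`, `x = √(y₀²+y₁²) − 1`, `y = y₂`, `z = y₃`; Taubes GT 2 (1998) eq. (1.1)),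
while `ω` is non-degenerate off the two core circles `Z = φ 0 (core) ∪ φ 1 (core)`.  Hence `ω` is
near-symplectic (transverse vanishing is read off the model), `Z` = two circles, both UNTWISTED (the
lone eigen-axis of the model is the constant direction `∂_{y₃}`).  Proof plan: Gerig AGT 21 (2021)
Thm 1.6 (asymptotically standard near-symplectic forms on `Σ ∖ pt`, after Taubes MRL 13 (2006));
Luttinger's trade "one twisted ↦ two untwisted" + Perutz's surgeries (math/0601320 Thm 1.4, Rem 1.9)
to reach exactly two untwisted circles (Gerig 2021 p. 4: the number of untwisted circles on `Σ ∖ pt`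
is even); Taubes 1998 §1.c: homotopy through near-symplectic forms with fixed zero set, supported
near `Z`, to the model (1.1) ON THE NOSE near each untwisted circle; finally transport "standard
outside a compact set" to `IsStandardOnBall` in the chart at `p` (tree: `ClosedModelExtension`,
Palais/Cerf disc theorem).  Why it might fail: only the last transport is not verbatim in print.
[cite: arXiv:1905.10938, Thm 1.6 and p. 4] [cite: arXiv:math/9901142, eq. (1.1) and §1.c]
[cite: arXiv:math/0601320, Thm 1.4, Thm 1.8, Rem 1.9] -/
theorem stub_nearSymplecticNormalForm :
    ∀ (S : HomotopySphere 4) (p : S.carrier),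
      ∃ (ε δ : ℝ) (sf : MForm (𝓡 4) (punctured p) ℝ 2) (φ : (Fin 2 → E4 → punctured p)),
      (0 < ε ∧ Metric.closedBall (extChartAt (𝓡 4) p p) ε ⊆ (extChartAt (𝓡 4) p).target ∧
      0 < δ ∧ δ < 1 ∧
      IsSmoothForm sf ∧ IsClosedForm sf ∧ IsStandardOnBall p ε sf ∧
      (∀ i : Fin 2,
        Set.InjOn (φ i) {y : E4 | (Real.sqrt (y 0 ^ 2 + y 1 ^ 2) - 1) ^ 2 + y 2 ^ 2 + y 3 ^ 2 < δ ^ 2} ∧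
        ContMDiffOn 𝓘(ℝ, E4) (𝓡 4) ∞ (φ i) {y : E4 | (Real.sqrt (y 0 ^ 2 + y 1 ^ 2) - 1) ^ 2 + y 2 ^ 2 + y 3 ^ 2 < δ ^ 2} ∧
        (∀ q ∈ {y : E4 | (Real.sqrt (y 0 ^ 2 + y 1 ^ 2) - 1) ^ 2 + y 2 ^ 2 + y 3 ^ 2 < δ ^ 2},
          Function.Injective (mfderiv 𝓘(ℝ, E4) (𝓡 4) (φ i) q)) ∧
        (∀ q ∈ {y : E4 | (Real.sqrt (y 0 ^ 2 + y 1 ^ 2) - 1) ^ 2 + y 2 ^ 2 + y 3 ^ 2 < δ ^ 2},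
          ¬ InPuncturedChartBall p ε (φ i q)) ∧
        (∀ q ∈ {y : E4 | (Real.sqrt (y 0 ^ 2 + y 1 ^ 2) - 1) ^ 2 + y 2 ^ 2 + y 3 ^ 2 < δ ^ 2},
          ∀ a b : E4,
          sf (φ i q) ![mfderiv 𝓘(ℝ, E4) (𝓡 4) (φ i) q a, mfderiv 𝓘(ℝ, E4) (𝓡 4) (φ i) q b] =
            ((q 0 * a 1 - q 1 * a 0) / (q 0 ^ 2 + q 1 ^ 2)) * ((Real.sqrt (q 0 ^ 2 + q 1 ^ 2) - 1) * ((q 0 * b 0 + q 1 * b 1) / Real.sqrt (q 0 ^ 2 + q 1 ^ 2)) + q 2 * b 2 - 2 * q 3 * b 3)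
            - ((q 0 * b 1 - q 1 * b 0) / (q 0 ^ 2 + q 1 ^ 2)) * ((Real.sqrt (q 0 ^ 2 + q 1 ^ 2) - 1) * ((q 0 * a 0 + q 1 * a 1) / Real.sqrt (q 0 ^ 2 + q 1 ^ 2)) + q 2 * a 2 - 2 * q 3 * a 3)
            + (Real.sqrt (q 0 ^ 2 + q 1 ^ 2) - 1) * (a 2 * b 3 - b 2 * a 3)
            - q 2 * (((q 0 * a 0 + q 1 * a 1) / Real.sqrt (q 0 ^ 2 + q 1 ^ 2)) * b 3 - ((q 0 * b 0 + q 1 * b 1) / Real.sqrt (q 0 ^ 2 + q 1 ^ 2)) * a 3)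
            - 2 * q 3 * (((q 0 * a 0 + q 1 * a 1) / Real.sqrt (q 0 ^ 2 + q 1 ^ 2)) * b 2 - ((q 0 * b 0 + q 1 * b 1) / Real.sqrt (q 0 ^ 2 + q 1 ^ 2)) * a 2))) ∧
      Disjoint (φ 0 '' {y : E4 | (Real.sqrt (y 0 ^ 2 + y 1 ^ 2) - 1) ^ 2 + y 2 ^ 2 + y 3 ^ 2 < δ ^ 2})
        (φ 1 '' {y : E4 | (Real.sqrt (y 0 ^ 2 + y 1 ^ 2) - 1) ^ 2 + y 2 ^ 2 + y 3 ^ 2 < δ ^ 2}) ∧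
      (∀ x : punctured p, (∀ i : Fin 2, x ∉ φ i '' {y : E4 | y 0 ^ 2 + y 1 ^ 2 = 1 ∧ y 2 = 0 ∧ y 3 = 0}) →
        ∀ v : TangentSpace (𝓡 4) x, v ≠ 0 → ∃ v' : TangentSpace (𝓡 4) x, sf x ![v, v'] ≠ 0)) := by
  sorry

/-- **Stub 2 — `GerigCurve`: Seiberg–Witten blindness as a resource — spanning half-cylinders exist
(XL; TRUE for every `Σ` by Gerig's Main Result 2, modulo the translation from his completed setting to
Taubes' finite-energy setting).**  For every datum of Stub 1 there is an ADMISSIBLE `J` on `Σ ∖ p`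
— `J² = −1`, smooth and `ω`-tame off `Z`; STANDARD on the punctured `ε`-ball (`Dι∘De ∘ J = i ∘ Dι∘De`,
the clause of `HyperbolicEnd`); and in each tube THE model structure of Taubes 1998 eq. (1.4), pinned by
`ω(Dφ a, J Dφ b) = √(x² + y² + 4z²) · g_T(a, b)` with `g_T = dt² + dx² + dy² + dz²` the flat product
metric (i.e. `J = √2 g_T⁻¹ ω_T/|ω_T|`) — such that EACH zero circle `Zᵢ` is the degree-one end of a
finite-energy `J`-holomorphic punctured plane: a map `u : ℂ → Σ ∖ p`, `C^∞` and `J`-holomorphic on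
`ℂ ∖ 0`, missing `Z` there, with `∫ u*ω < ∞`, which for `0 < ‖z‖ < r₁` lies in the tube `φ i (T_δ)`,
whose tube-radius tends to `0` as `z → 0` and whose core angle tends radially to a rotation of degree
`σ = ±1` of `arg z`.  Engine: Gerig AGT 21 (2021) Main Results 1–2 (for `ω` with untwisted circles only,
the ECH/relative-SW count of curves bounding `Z` equals its `ℝ⁴` value `1 mod 2`, so a curve with
intersection number one with each linking 2-sphere EXISTS on every `Σ ∖ pt`; components embedded or covers
of an embedded plane) — blindness of gauge theory to `Σ` is exactly why existence is free; Taubes GT 3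
(1999) Thm 1.1 is the compact prototype; Taubes 1998 Thm 1.8 gives the structure of finite-energy curves
at `Z`.  Why it might fail: Gerig's curves live in the completion of `Σ∖(p ∪ N(Z))` for a MODIFIED contact
form on `∂N`; shrinking `N` to `Z` with Taubes' model `(ω_T, J_T)` is only "expected" (Gerig GT 24 (2020)
p. 7), and the degree-one core asymptotics must be extracted from Taubes 1998 §5–6.
[cite: arXiv:1905.10938, Main Result 2] [cite: arXiv:math/9907199, Thm 1.1]
[cite: arXiv:math/9901142, eq. (1.4), Thm 1.8] [cite: arXiv:1711.02069, §1.3] -/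
theorem stub_spanningHalfCylinders :
    ∀ (S : HomotopySphere 4) (p : S.carrier) (ε δ : ℝ) (sf : MForm (𝓡 4) (punctured p) ℝ 2) (φ : (Fin 2 → E4 → punctured p)),
      (0 < ε ∧ Metric.closedBall (extChartAt (𝓡 4) p p) ε ⊆ (extChartAt (𝓡 4) p).target ∧
      0 < δ ∧ δ < 1 ∧
      IsSmoothForm sf ∧ IsClosedForm sf ∧ IsStandardOnBall p ε sf ∧
      (∀ i : Fin 2,
        Set.InjOn (φ i) {y : E4 | (Real.sqrt (y 0 ^ 2 + y 1 ^ 2) - 1) ^ 2 + y 2 ^ 2 + y 3 ^ 2 < δ ^ 2} ∧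
        ContMDiffOn 𝓘(ℝ, E4) (𝓡 4) ∞ (φ i) {y : E4 | (Real.sqrt (y 0 ^ 2 + y 1 ^ 2) - 1) ^ 2 + y 2 ^ 2 + y 3 ^ 2 < δ ^ 2} ∧
        (∀ q ∈ {y : E4 | (Real.sqrt (y 0 ^ 2 + y 1 ^ 2) - 1) ^ 2 + y 2 ^ 2 + y 3 ^ 2 < δ ^ 2},
          Function.Injective (mfderiv 𝓘(ℝ, E4) (𝓡 4) (φ i) q)) ∧
        (∀ q ∈ {y : E4 | (Real.sqrt (y 0 ^ 2 + y 1 ^ 2) - 1) ^ 2 + y 2 ^ 2 + y 3 ^ 2 < δ ^ 2},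
          ¬ InPuncturedChartBall p ε (φ i q)) ∧
        (∀ q ∈ {y : E4 | (Real.sqrt (y 0 ^ 2 + y 1 ^ 2) - 1) ^ 2 + y 2 ^ 2 + y 3 ^ 2 < δ ^ 2},
          ∀ a b : E4,
          sf (φ i q) ![mfderiv 𝓘(ℝ, E4) (𝓡 4) (φ i) q a, mfderiv 𝓘(ℝ, E4) (𝓡 4) (φ i) q b] =
            ((q 0 * a 1 - q 1 * a 0) / (q 0 ^ 2 + q 1 ^ 2)) * ((Real.sqrt (q 0 ^ 2 + q 1 ^ 2) - 1) * ((q 0 * b 0 + q 1 * b 1) / Real.sqrt (q 0 ^ 2 + q 1 ^ 2)) + q 2 * b 2 - 2 * q 3 * b 3)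
            - ((q 0 * b 1 - q 1 * b 0) / (q 0 ^ 2 + q 1 ^ 2)) * ((Real.sqrt (q 0 ^ 2 + q 1 ^ 2) - 1) * ((q 0 * a 0 + q 1 * a 1) / Real.sqrt (q 0 ^ 2 + q 1 ^ 2)) + q 2 * a 2 - 2 * q 3 * a 3)
            + (Real.sqrt (q 0 ^ 2 + q 1 ^ 2) - 1) * (a 2 * b 3 - b 2 * a 3)
            - q 2 * (((q 0 * a 0 + q 1 * a 1) / Real.sqrt (q 0 ^ 2 + q 1 ^ 2)) * b 3 - ((q 0 * b 0 + q 1 * b 1) / Real.sqrt (q 0 ^ 2 + q 1 ^ 2)) * a 3)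
            - 2 * q 3 * (((q 0 * a 0 + q 1 * a 1) / Real.sqrt (q 0 ^ 2 + q 1 ^ 2)) * b 2 - ((q 0 * b 0 + q 1 * b 1) / Real.sqrt (q 0 ^ 2 + q 1 ^ 2)) * a 2))) ∧
      Disjoint (φ 0 '' {y : E4 | (Real.sqrt (y 0 ^ 2 + y 1 ^ 2) - 1) ^ 2 + y 2 ^ 2 + y 3 ^ 2 < δ ^ 2})
        (φ 1 '' {y : E4 | (Real.sqrt (y 0 ^ 2 + y 1 ^ 2) - 1) ^ 2 + y 2 ^ 2 + y 3 ^ 2 < δ ^ 2}) ∧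
      (∀ x : punctured p, (∀ i : Fin 2, x ∉ φ i '' {y : E4 | y 0 ^ 2 + y 1 ^ 2 = 1 ∧ y 2 = 0 ∧ y 3 = 0}) →
        ∀ v : TangentSpace (𝓡 4) x, v ≠ 0 → ∃ v' : TangentSpace (𝓡 4) x, sf x ![v, v'] ≠ 0)) →
      ∃ J : (∀ x : punctured p, TangentSpace (𝓡 4) x →L[ℝ] TangentSpace (𝓡 4) x),
        ((∀ x : punctured p, (∀ i : Fin 2, x ∉ φ i '' {y : E4 | y 0 ^ 2 + y 1 ^ 2 = 1 ∧ y 2 = 0 ∧ y 3 = 0}) →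
          ∀ v : TangentSpace (𝓡 4) x, J x (J x v) = -v) ∧
        (∀ x₀ : punctured p, (∀ i : Fin 2, x₀ ∉ φ i '' {y : E4 | y 0 ^ 2 + y 1 ^ 2 = 1 ∧ y 2 = 0 ∧ y 3 = 0}) →
          ContMDiffAt (𝓡 4) 𝓘(ℝ, E4 →L[ℝ] E4) ∞
            (inTangentCoordinates (𝓡 4) (𝓡 4) (id : punctured p → punctured p) id (fun x => J x) x₀) x₀) ∧
        (∀ x : punctured p, (∀ i : Fin 2, x ∉ φ i '' {y : E4 | y 0 ^ 2 + y 1 ^ 2 = 1 ∧ y 2 = 0 ∧ y 3 = 0}) →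
          ∀ v : TangentSpace (𝓡 4) x, v ≠ 0 → 0 < sf x ![v, J x v]) ∧
        (∀ x : punctured p, InPuncturedChartBall p ε x → ∀ (v : TangentSpace (𝓡 4) x) (b : E4),
          inner ℝ (fderiv ℝ inversion (extChartAt (𝓡 4) p x.1 - extChartAt (𝓡 4) p p)
            (mfderiv (𝓡 4) 𝓘(ℝ, E4) (fun z : punctured p => extChartAt (𝓡 4) p z.1) x (J x v))) b =
          stdSymplecticForm (fderiv ℝ inversion (extChartAt (𝓡 4) p x.1 - extChartAt (𝓡 4) p p)
            (mfderiv (𝓡 4) 𝓘(ℝ, E4) (fun z : punctured p => extChartAt (𝓡 4) p z.1) x v)) b) ∧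
        (∀ i : Fin 2, ∀ q ∈ {y : E4 | (Real.sqrt (y 0 ^ 2 + y 1 ^ 2) - 1) ^ 2 + y 2 ^ 2 + y 3 ^ 2 < δ ^ 2},
          ¬ (q 0 ^ 2 + q 1 ^ 2 = 1 ∧ q 2 = 0 ∧ q 3 = 0) → ∀ a b : E4,
          sf (φ i q) ![mfderiv 𝓘(ℝ, E4) (𝓡 4) (φ i) q a, J (φ i q) (mfderiv 𝓘(ℝ, E4) (𝓡 4) (φ i) q b)] =
            Real.sqrt ((Real.sqrt (q 0 ^ 2 + q 1 ^ 2) - 1) ^ 2 + q 2 ^ 2 + 4 * q 3 ^ 2) *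
            (((q 0 * a 1 - q 1 * a 0) / (q 0 ^ 2 + q 1 ^ 2)) * ((q 0 * b 1 - q 1 * b 0) / (q 0 ^ 2 + q 1 ^ 2)) + ((q 0 * a 0 + q 1 * a 1) / Real.sqrt (q 0 ^ 2 + q 1 ^ 2)) * ((q 0 * b 0 + q 1 * b 1) / Real.sqrt (q 0 ^ 2 + q 1 ^ 2)) + a 2 * b 2 + a 3 * b 3))) ∧
        ∀ i : Fin 2, ∃ u : ℂ → punctured p,
          ((∀ z : ℂ, z ≠ 0 → ContMDiffAt 𝓘(ℝ, ℂ) (𝓡 4) ∞ u z) ∧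
          IsJHolomorphicOn (𝓡 4) J u {z : ℂ | z ≠ 0} ∧
          (∀ z : ℂ, z ≠ 0 → ∀ i : Fin 2, u z ∉ φ i '' {y : E4 | y 0 ^ 2 + y 1 ^ 2 = 1 ∧ y 2 = 0 ∧ y 3 = 0}) ∧
          MeasureTheory.Integrable (fun z : ℂ =>
            sf (u z) ![mfderiv 𝓘(ℝ, ℂ) (𝓡 4) u z (1 : ℂ), mfderiv 𝓘(ℝ, ℂ) (𝓡 4) u z Complex.I])) ∧
          (∃ (uh : ℂ → E4) (r₁ c : ℝ) (σ : ℤ), 0 < r₁ ∧ (σ = 1 ∨ σ = -1) ∧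
            (∀ z : ℂ, z ≠ 0 → ‖z‖ < r₁ →
              uh z ∈ {y : E4 | (Real.sqrt (y 0 ^ 2 + y 1 ^ 2) - 1) ^ 2 + y 2 ^ 2 + y 3 ^ 2 < δ ^ 2} ∧ u z = φ i (uh z)) ∧
            Tendsto (fun z : ℂ => ((Real.sqrt (uh z 0 ^ 2 + uh z 1 ^ 2) - 1) ^ 2 + uh z 2 ^ 2 + uh z 3 ^ 2)) (𝓝[≠] 0) (𝓝 0) ∧
            (∀ θ : ℝ, Tendsto (fun s : ℝ =>
                uh ((s : ℂ) * Complex.exp ((θ : ℂ) * Complex.I)) 0 / Real.sqrt (uh ((s : ℂ) * Complex.exp ((θ : ℂ) * Complex.I)) 0 ^ 2 + uh ((s : ℂ) * Complex.exp ((θ : ℂ) * Complex.I)) 1 ^ 2))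
              (𝓝[>] 0) (𝓝 (Real.cos ((σ : ℝ) * θ + c)))) ∧
            (∀ θ : ℝ, Tendsto (fun s : ℝ =>
                uh ((s : ℂ) * Complex.exp ((θ : ℂ) * Complex.I)) 1 / Real.sqrt (uh ((s : ℂ) * Complex.exp ((θ : ℂ) * Complex.I)) 0 ^ 2 + uh ((s : ℂ) * Complex.exp ((θ : ℂ) * Complex.I)) 1 ^ 2))
              (𝓝[>] 0) (𝓝 (Real.sin ((σ : ℝ) * θ + c))))) := by
  sorry

set_option maxHeartbeats 2000000 in
set_option maxRecDepth 8000 in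
/-- **Stub 3 — `CylinderSelection`, APEX A (the SPC4-carrier; XL / open).**  On a punctured homotopy
4-sphere, from ANY datum of Stubs 1–2 (near-symplectic `ω` with two untwisted model circles, admissible
`J`, a finite-energy half-cylinder at each circle) one can pass to a datum `(ω', φ', J', u)` of the same
kind in which `u` is a finite-energy `J'`-holomorphic CYLINDER `ℂ ∖ 0 → Σ ∖ p ∖ Z'` with a degree-one end
on `Z'₁ = φ' 0 (core)` at `0` and a degree-one end on `Z'₂ = φ' 1 (core)` at `∞`, which is GEOMETRICALLY
UNIQUE: every finite-energy `J'`-holomorphic punctured plane with an end of ANY non-zero degree on `Z'₁`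
at `0`, and every one with such an end on `Z'₂` at `∞`, is `u (a ·)` for some `a ≠ 0` (so: no second
cylinder, no plane capping either circle, no multiply-wrapped ends).  This is the half of Gerig's
Question 1 ("is there a unique pseudoholomorphic cylinder bounding it?", AGT 21 (2021) p. 4) that an
exotic `Σ` must violate: Stubs 4–5 turn uniqueness into a symplectic form standard near `p`, i.e. into
`Target` (hence SPC4 for `Σ`, p120412).  Why it should hold for `Σ ≅ S⁴` (= the line's CHEAPEST
FALSIFIER, a model computation): Luttinger's birth (Gerig 2021 Ex. 1.7) followed by the trade gives on
`ℝ⁴` two untwisted circles born as a cancelling pair; in the `S¹`-invariant cancelling model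
`(S¹ × B³, dt∧df_ε + ⋆df_ε)`, `f_ε = x³ − 3xy² − εx + y² − z²` (harmonic, index-1/index-2 pair
`(±√(ε/3), 0, 0)`), the invariant finite-energy curves incident to `Z` are `S¹ ×` (connecting orbits)
= the single axis cylinder (Gerig GT 26 (2022) §1.5; Taubes 1998 Ex. 1.3).  WHERE `π₁(Σ) = 1` ENTERS
(answer to the `ℂP² # (S²×S²)/ℤ₂` control of the OrigamiFoldExistence panel): the algebraic count of
spanning cylinders is Gerig's relative Seiberg–Witten invariant, a sum over spin-c structures of the
cobordism `S³ → ∂N(Z)`; it is `1` because `H²(Σ∖p; ℤ) = 0`, whereas on the rational ball `(S²×S²)/ℤ₂ ∖ pt`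
(`H² ⊇ ℤ/2`) the count is even and uniqueness is impossible — as it must be, that manifold carrying no
symplectic form standard at infinity.  Passing from algebraic count `1` (Stub 2) to geometric count `1`
is the Whitney-move step of the h-cobordism dictionary: exactly the 4-dimensional gap.  Why it might
fail: for an exotic `Σ` it is false by design (zero slack); and even on `S⁴` the model may carry
non-invariant finite-energy planes from the lone axis (Taubes 1998 Ex. 1.4) — then reshape to Taubes'
full class of finite-energy subvarieties or to the twisted-circle/disc normal form (Gerig Q1, first half).
[cite: arXiv:1905.10938, Question 1, Ex. 1.7, Main Result 1] [cite: arXiv:1809.03405, §1.5]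
[cite: arXiv:math/9901142, Ex. 1.3–1.4] -/
theorem stub_cylinderSelection :
    ∀ (S : HomotopySphere 4) (p : S.carrier) (ε δ : ℝ) (sf : MForm (𝓡 4) (punctured p) ℝ 2) (φ : (Fin 2 → E4 → punctured p)),
      (0 < ε ∧ Metric.closedBall (extChartAt (𝓡 4) p p) ε ⊆ (extChartAt (𝓡 4) p).target ∧
      0 < δ ∧ δ < 1 ∧
      IsSmoothForm sf ∧ IsClosedForm sf ∧ IsStandardOnBall p ε sf ∧
      (∀ i : Fin 2,
        Set.InjOn (φ i) {y : E4 | (Real.sqrt (y 0 ^ 2 + y 1 ^ 2) - 1) ^ 2 + y 2 ^ 2 + y 3 ^ 2 < δ ^ 2} ∧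
        ContMDiffOn 𝓘(ℝ, E4) (𝓡 4) ∞ (φ i) {y : E4 | (Real.sqrt (y 0 ^ 2 + y 1 ^ 2) - 1) ^ 2 + y 2 ^ 2 + y 3 ^ 2 < δ ^ 2} ∧
        (∀ q ∈ {y : E4 | (Real.sqrt (y 0 ^ 2 + y 1 ^ 2) - 1) ^ 2 + y 2 ^ 2 + y 3 ^ 2 < δ ^ 2},
          Function.Injective (mfderiv 𝓘(ℝ, E4) (𝓡 4) (φ i) q)) ∧
        (∀ q ∈ {y : E4 | (Real.sqrt (y 0 ^ 2 + y 1 ^ 2) - 1) ^ 2 + y 2 ^ 2 + y 3 ^ 2 < δ ^ 2},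
          ¬ InPuncturedChartBall p ε (φ i q)) ∧
        (∀ q ∈ {y : E4 | (Real.sqrt (y 0 ^ 2 + y 1 ^ 2) - 1) ^ 2 + y 2 ^ 2 + y 3 ^ 2 < δ ^ 2},
          ∀ a b : E4,
          sf (φ i q) ![mfderiv 𝓘(ℝ, E4) (𝓡 4) (φ i) q a, mfderiv 𝓘(ℝ, E4) (𝓡 4) (φ i) q b] =
            ((q 0 * a 1 - q 1 * a 0) / (q 0 ^ 2 + q 1 ^ 2)) * ((Real.sqrt (q 0 ^ 2 + q 1 ^ 2) - 1) * ((q 0 * b 0 + q 1 * b 1) / Real.sqrt (q 0 ^ 2 + q 1 ^ 2)) + q 2 * b 2 - 2 * q 3 * b 3)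
            - ((q 0 * b 1 - q 1 * b 0) / (q 0 ^ 2 + q 1 ^ 2)) * ((Real.sqrt (q 0 ^ 2 + q 1 ^ 2) - 1) * ((q 0 * a 0 + q 1 * a 1) / Real.sqrt (q 0 ^ 2 + q 1 ^ 2)) + q 2 * a 2 - 2 * q 3 * a 3)
            + (Real.sqrt (q 0 ^ 2 + q 1 ^ 2) - 1) * (a 2 * b 3 - b 2 * a 3)
            - q 2 * (((q 0 * a 0 + q 1 * a 1) / Real.sqrt (q 0 ^ 2 + q 1 ^ 2)) * b 3 - ((q 0 * b 0 + q 1 * b 1) / Real.sqrt (q 0 ^ 2 + q 1 ^ 2)) * a 3)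
            - 2 * q 3 * (((q 0 * a 0 + q 1 * a 1) / Real.sqrt (q 0 ^ 2 + q 1 ^ 2)) * b 2 - ((q 0 * b 0 + q 1 * b 1) / Real.sqrt (q 0 ^ 2 + q 1 ^ 2)) * a 2))) ∧
      Disjoint (φ 0 '' {y : E4 | (Real.sqrt (y 0 ^ 2 + y 1 ^ 2) - 1) ^ 2 + y 2 ^ 2 + y 3 ^ 2 < δ ^ 2})
        (φ 1 '' {y : E4 | (Real.sqrt (y 0 ^ 2 + y 1 ^ 2) - 1) ^ 2 + y 2 ^ 2 + y 3 ^ 2 < δ ^ 2}) ∧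
      (∀ x : punctured p, (∀ i : Fin 2, x ∉ φ i '' {y : E4 | y 0 ^ 2 + y 1 ^ 2 = 1 ∧ y 2 = 0 ∧ y 3 = 0}) →
        ∀ v : TangentSpace (𝓡 4) x, v ≠ 0 → ∃ v' : TangentSpace (𝓡 4) x, sf x ![v, v'] ≠ 0)) →
      ∀ J : (∀ x : punctured p, TangentSpace (𝓡 4) x →L[ℝ] TangentSpace (𝓡 4) x),
      ((∀ x : punctured p, (∀ i : Fin 2, x ∉ φ i '' {y : E4 | y 0 ^ 2 + y 1 ^ 2 = 1 ∧ y 2 = 0 ∧ y 3 = 0}) →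
        ∀ v : TangentSpace (𝓡 4) x, J x (J x v) = -v) ∧
      (∀ x₀ : punctured p, (∀ i : Fin 2, x₀ ∉ φ i '' {y : E4 | y 0 ^ 2 + y 1 ^ 2 = 1 ∧ y 2 = 0 ∧ y 3 = 0}) →
        ContMDiffAt (𝓡 4) 𝓘(ℝ, E4 →L[ℝ] E4) ∞
          (inTangentCoordinates (𝓡 4) (𝓡 4) (id : punctured p → punctured p) id (fun x => J x) x₀) x₀) ∧
      (∀ x : punctured p, (∀ i : Fin 2, x ∉ φ i '' {y : E4 | y 0 ^ 2 + y 1 ^ 2 = 1 ∧ y 2 = 0 ∧ y 3 = 0}) →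
        ∀ v : TangentSpace (𝓡 4) x, v ≠ 0 → 0 < sf x ![v, J x v]) ∧
      (∀ x : punctured p, InPuncturedChartBall p ε x → ∀ (v : TangentSpace (𝓡 4) x) (b : E4),
        inner ℝ (fderiv ℝ inversion (extChartAt (𝓡 4) p x.1 - extChartAt (𝓡 4) p p)
          (mfderiv (𝓡 4) 𝓘(ℝ, E4) (fun z : punctured p => extChartAt (𝓡 4) p z.1) x (J x v))) b =
        stdSymplecticForm (fderiv ℝ inversion (extChartAt (𝓡 4) p x.1 - extChartAt (𝓡 4) p p)
          (mfderiv (𝓡 4) 𝓘(ℝ, E4) (fun z : punctured p => extChartAt (𝓡 4) p z.1) x v)) b) ∧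
      (∀ i : Fin 2, ∀ q ∈ {y : E4 | (Real.sqrt (y 0 ^ 2 + y 1 ^ 2) - 1) ^ 2 + y 2 ^ 2 + y 3 ^ 2 < δ ^ 2},
        ¬ (q 0 ^ 2 + q 1 ^ 2 = 1 ∧ q 2 = 0 ∧ q 3 = 0) → ∀ a b : E4,
        sf (φ i q) ![mfderiv 𝓘(ℝ, E4) (𝓡 4) (φ i) q a, J (φ i q) (mfderiv 𝓘(ℝ, E4) (𝓡 4) (φ i) q b)] =
          Real.sqrt ((Real.sqrt (q 0 ^ 2 + q 1 ^ 2) - 1) ^ 2 + q 2 ^ 2 + 4 * q 3 ^ 2) *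
          (((q 0 * a 1 - q 1 * a 0) / (q 0 ^ 2 + q 1 ^ 2)) * ((q 0 * b 1 - q 1 * b 0) / (q 0 ^ 2 + q 1 ^ 2)) + ((q 0 * a 0 + q 1 * a 1) / Real.sqrt (q 0 ^ 2 + q 1 ^ 2)) * ((q 0 * b 0 + q 1 * b 1) / Real.sqrt (q 0 ^ 2 + q 1 ^ 2)) + a 2 * b 2 + a 3 * b 3))) →
      (∀ i : Fin 2, ∃ u : ℂ → punctured p,
        ((∀ z : ℂ, z ≠ 0 → ContMDiffAt 𝓘(ℝ, ℂ) (𝓡 4) ∞ u z) ∧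
        IsJHolomorphicOn (𝓡 4) J u {z : ℂ | z ≠ 0} ∧
        (∀ z : ℂ, z ≠ 0 → ∀ i : Fin 2, u z ∉ φ i '' {y : E4 | y 0 ^ 2 + y 1 ^ 2 = 1 ∧ y 2 = 0 ∧ y 3 = 0}) ∧
        MeasureTheory.Integrable (fun z : ℂ =>
          sf (u z) ![mfderiv 𝓘(ℝ, ℂ) (𝓡 4) u z (1 : ℂ), mfderiv 𝓘(ℝ, ℂ) (𝓡 4) u z Complex.I])) ∧
        (∃ (uh : ℂ → E4) (r₁ c : ℝ) (σ : ℤ), 0 < r₁ ∧ (σ = 1 ∨ σ = -1) ∧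
          (∀ z : ℂ, z ≠ 0 → ‖z‖ < r₁ →
            uh z ∈ {y : E4 | (Real.sqrt (y 0 ^ 2 + y 1 ^ 2) - 1) ^ 2 + y 2 ^ 2 + y 3 ^ 2 < δ ^ 2} ∧ u z = φ i (uh z)) ∧
          Tendsto (fun z : ℂ => ((Real.sqrt (uh z 0 ^ 2 + uh z 1 ^ 2) - 1) ^ 2 + uh z 2 ^ 2 + uh z 3 ^ 2)) (𝓝[≠] 0) (𝓝 0) ∧
          (∀ θ : ℝ, Tendsto (fun s : ℝ =>
              uh ((s : ℂ) * Complex.exp ((θ : ℂ) * Complex.I)) 0 / Real.sqrt (uh ((s : ℂ) * Complex.exp ((θ : ℂ) * Complex.I)) 0 ^ 2 + uh ((s : ℂ) * Complex.exp ((θ : ℂ) * Complex.I)) 1 ^ 2))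
            (𝓝[>] 0) (𝓝 (Real.cos ((σ : ℝ) * θ + c)))) ∧
          (∀ θ : ℝ, Tendsto (fun s : ℝ =>
              uh ((s : ℂ) * Complex.exp ((θ : ℂ) * Complex.I)) 1 / Real.sqrt (uh ((s : ℂ) * Complex.exp ((θ : ℂ) * Complex.I)) 0 ^ 2 + uh ((s : ℂ) * Complex.exp ((θ : ℂ) * Complex.I)) 1 ^ 2))
            (𝓝[>] 0) (𝓝 (Real.sin ((σ : ℝ) * θ + c)))))) →
      ∃ (ε' δ' : ℝ) (sf' : MForm (𝓡 4) (punctured p) ℝ 2) (φ' : (Fin 2 → E4 → punctured p)) (J' : ∀ x : punctured p, TangentSpace (𝓡 4) x →L[ℝ] TangentSpace (𝓡 4) x) (u : ℂ → punctured p),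
        (0 < ε' ∧ Metric.closedBall (extChartAt (𝓡 4) p p) ε' ⊆ (extChartAt (𝓡 4) p).target ∧
        0 < δ' ∧ δ' < 1 ∧
        IsSmoothForm sf' ∧ IsClosedForm sf' ∧ IsStandardOnBall p ε' sf' ∧
        (∀ i : Fin 2,
          Set.InjOn (φ' i) {y : E4 | (Real.sqrt (y 0 ^ 2 + y 1 ^ 2) - 1) ^ 2 + y 2 ^ 2 + y 3 ^ 2 < δ' ^ 2} ∧
          ContMDiffOn 𝓘(ℝ, E4) (𝓡 4) ∞ (φ' i) {y : E4 | (Real.sqrt (y 0 ^ 2 + y 1 ^ 2) - 1) ^ 2 + y 2 ^ 2 + y 3 ^ 2 < δ' ^ 2} ∧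
          (∀ q ∈ {y : E4 | (Real.sqrt (y 0 ^ 2 + y 1 ^ 2) - 1) ^ 2 + y 2 ^ 2 + y 3 ^ 2 < δ' ^ 2},
            Function.Injective (mfderiv 𝓘(ℝ, E4) (𝓡 4) (φ' i) q)) ∧
          (∀ q ∈ {y : E4 | (Real.sqrt (y 0 ^ 2 + y 1 ^ 2) - 1) ^ 2 + y 2 ^ 2 + y 3 ^ 2 < δ' ^ 2},
            ¬ InPuncturedChartBall p ε' (φ' i q)) ∧
          (∀ q ∈ {y : E4 | (Real.sqrt (y 0 ^ 2 + y 1 ^ 2) - 1) ^ 2 + y 2 ^ 2 + y 3 ^ 2 < δ' ^ 2},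
            ∀ a b : E4,
            sf' (φ' i q) ![mfderiv 𝓘(ℝ, E4) (𝓡 4) (φ' i) q a, mfderiv 𝓘(ℝ, E4) (𝓡 4) (φ' i) q b] =
              ((q 0 * a 1 - q 1 * a 0) / (q 0 ^ 2 + q 1 ^ 2)) * ((Real.sqrt (q 0 ^ 2 + q 1 ^ 2) - 1) * ((q 0 * b 0 + q 1 * b 1) / Real.sqrt (q 0 ^ 2 + q 1 ^ 2)) + q 2 * b 2 - 2 * q 3 * b 3)
              - ((q 0 * b 1 - q 1 * b 0) / (q 0 ^ 2 + q 1 ^ 2)) * ((Real.sqrt (q 0 ^ 2 + q 1 ^ 2) - 1) * ((q 0 * a 0 + q 1 * a 1) / Real.sqrt (q 0 ^ 2 + q 1 ^ 2)) + q 2 * a 2 - 2 * q 3 * a 3)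
              + (Real.sqrt (q 0 ^ 2 + q 1 ^ 2) - 1) * (a 2 * b 3 - b 2 * a 3)
              - q 2 * (((q 0 * a 0 + q 1 * a 1) / Real.sqrt (q 0 ^ 2 + q 1 ^ 2)) * b 3 - ((q 0 * b 0 + q 1 * b 1) / Real.sqrt (q 0 ^ 2 + q 1 ^ 2)) * a 3)
              - 2 * q 3 * (((q 0 * a 0 + q 1 * a 1) / Real.sqrt (q 0 ^ 2 + q 1 ^ 2)) * b 2 - ((q 0 * b 0 + q 1 * b 1) / Real.sqrt (q 0 ^ 2 + q 1 ^ 2)) * a 2))) ∧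
        Disjoint (φ' 0 '' {y : E4 | (Real.sqrt (y 0 ^ 2 + y 1 ^ 2) - 1) ^ 2 + y 2 ^ 2 + y 3 ^ 2 < δ' ^ 2})
          (φ' 1 '' {y : E4 | (Real.sqrt (y 0 ^ 2 + y 1 ^ 2) - 1) ^ 2 + y 2 ^ 2 + y 3 ^ 2 < δ' ^ 2}) ∧
        (∀ x : punctured p, (∀ i : Fin 2, x ∉ φ' i '' {y : E4 | y 0 ^ 2 + y 1 ^ 2 = 1 ∧ y 2 = 0 ∧ y 3 = 0}) →
          ∀ v : TangentSpace (𝓡 4) x, v ≠ 0 → ∃ v' : TangentSpace (𝓡 4) x, sf' x ![v, v'] ≠ 0)) ∧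
        ((∀ x : punctured p, (∀ i : Fin 2, x ∉ φ' i '' {y : E4 | y 0 ^ 2 + y 1 ^ 2 = 1 ∧ y 2 = 0 ∧ y 3 = 0}) →
          ∀ v : TangentSpace (𝓡 4) x, J' x (J' x v) = -v) ∧
        (∀ x₀ : punctured p, (∀ i : Fin 2, x₀ ∉ φ' i '' {y : E4 | y 0 ^ 2 + y 1 ^ 2 = 1 ∧ y 2 = 0 ∧ y 3 = 0}) →
          ContMDiffAt (𝓡 4) 𝓘(ℝ, E4 →L[ℝ] E4) ∞
            (inTangentCoordinates (𝓡 4) (𝓡 4) (id : punctured p → punctured p) id (fun x => J' x) x₀) x₀) ∧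
        (∀ x : punctured p, (∀ i : Fin 2, x ∉ φ' i '' {y : E4 | y 0 ^ 2 + y 1 ^ 2 = 1 ∧ y 2 = 0 ∧ y 3 = 0}) →
          ∀ v : TangentSpace (𝓡 4) x, v ≠ 0 → 0 < sf' x ![v, J' x v]) ∧
        (∀ x : punctured p, InPuncturedChartBall p ε' x → ∀ (v : TangentSpace (𝓡 4) x) (b : E4),
          inner ℝ (fderiv ℝ inversion (extChartAt (𝓡 4) p x.1 - extChartAt (𝓡 4) p p)
            (mfderiv (𝓡 4) 𝓘(ℝ, E4) (fun z : punctured p => extChartAt (𝓡 4) p z.1) x (J' x v))) b =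
          stdSymplecticForm (fderiv ℝ inversion (extChartAt (𝓡 4) p x.1 - extChartAt (𝓡 4) p p)
            (mfderiv (𝓡 4) 𝓘(ℝ, E4) (fun z : punctured p => extChartAt (𝓡 4) p z.1) x v)) b) ∧
        (∀ i : Fin 2, ∀ q ∈ {y : E4 | (Real.sqrt (y 0 ^ 2 + y 1 ^ 2) - 1) ^ 2 + y 2 ^ 2 + y 3 ^ 2 < δ' ^ 2},
          ¬ (q 0 ^ 2 + q 1 ^ 2 = 1 ∧ q 2 = 0 ∧ q 3 = 0) → ∀ a b : E4,
          sf' (φ' i q) ![mfderiv 𝓘(ℝ, E4) (𝓡 4) (φ' i) q a, J' (φ' i q) (mfderiv 𝓘(ℝ, E4) (𝓡 4) (φ' i) q b)] =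
            Real.sqrt ((Real.sqrt (q 0 ^ 2 + q 1 ^ 2) - 1) ^ 2 + q 2 ^ 2 + 4 * q 3 ^ 2) *
            (((q 0 * a 1 - q 1 * a 0) / (q 0 ^ 2 + q 1 ^ 2)) * ((q 0 * b 1 - q 1 * b 0) / (q 0 ^ 2 + q 1 ^ 2)) + ((q 0 * a 0 + q 1 * a 1) / Real.sqrt (q 0 ^ 2 + q 1 ^ 2)) * ((q 0 * b 0 + q 1 * b 1) / Real.sqrt (q 0 ^ 2 + q 1 ^ 2)) + a 2 * b 2 + a 3 * b 3))) ∧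
(((∀ z : ℂ, z ≠ 0 → ContMDiffAt 𝓘(ℝ, ℂ) (𝓡 4) ∞ u z) ∧
         IsJHolomorphicOn (𝓡 4) J' u {z : ℂ | z ≠ 0} ∧
         (∀ z : ℂ, z ≠ 0 → ∀ i : Fin 2, u z ∉ φ' i '' {y : E4 | y 0 ^ 2 + y 1 ^ 2 = 1 ∧ y 2 = 0 ∧ y 3 = 0}) ∧
         MeasureTheory.Integrable (fun z : ℂ =>
           sf' (u z) ![mfderiv 𝓘(ℝ, ℂ) (𝓡 4) u z (1 : ℂ), mfderiv 𝓘(ℝ, ℂ) (𝓡 4) u z Complex.I])) ∧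
         (∃ (uh : ℂ → E4) (r₁ c : ℝ) (σ : ℤ), 0 < r₁ ∧ (σ = 1 ∨ σ = -1) ∧
           (∀ z : ℂ, z ≠ 0 → ‖z‖ < r₁ →
             uh z ∈ {y : E4 | (Real.sqrt (y 0 ^ 2 + y 1 ^ 2) - 1) ^ 2 + y 2 ^ 2 + y 3 ^ 2 < δ' ^ 2} ∧ u z = φ' 0 (uh z)) ∧
           Tendsto (fun z : ℂ => ((Real.sqrt (uh z 0 ^ 2 + uh z 1 ^ 2) - 1) ^ 2 + uh z 2 ^ 2 + uh z 3 ^ 2)) (𝓝[≠] 0) (𝓝 0) ∧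
           (∀ θ : ℝ, Tendsto (fun s : ℝ =>
               uh ((s : ℂ) * Complex.exp ((θ : ℂ) * Complex.I)) 0 / Real.sqrt (uh ((s : ℂ) * Complex.exp ((θ : ℂ) * Complex.I)) 0 ^ 2 + uh ((s : ℂ) * Complex.exp ((θ : ℂ) * Complex.I)) 1 ^ 2))
             (𝓝[>] 0) (𝓝 (Real.cos ((σ : ℝ) * θ + c)))) ∧
           (∀ θ : ℝ, Tendsto (fun s : ℝ =>
               uh ((s : ℂ) * Complex.exp ((θ : ℂ) * Complex.I)) 1 / Real.sqrt (uh ((s : ℂ) * Complex.exp ((θ : ℂ) * Complex.I)) 0 ^ 2 + uh ((s : ℂ) * Complex.exp ((θ : ℂ) * Complex.I)) 1 ^ 2))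
             (𝓝[>] 0) (𝓝 (Real.sin ((σ : ℝ) * θ + c))))) ∧
         (∃ (uh : ℂ → E4) (R₂ c : ℝ) (σ : ℤ), 0 < R₂ ∧ (σ = 1 ∨ σ = -1) ∧
           (∀ z : ℂ, R₂ < ‖z‖ →
             uh z ∈ {y : E4 | (Real.sqrt (y 0 ^ 2 + y 1 ^ 2) - 1) ^ 2 + y 2 ^ 2 + y 3 ^ 2 < δ' ^ 2} ∧ u z = φ' 1 (uh z)) ∧
           Tendsto (fun z : ℂ => ((Real.sqrt (uh z 0 ^ 2 + uh z 1 ^ 2) - 1) ^ 2 + uh z 2 ^ 2 + uh z 3 ^ 2)) (Filter.cocompact ℂ) (𝓝 0) ∧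
           (∀ θ : ℝ, Tendsto (fun s : ℝ =>
               uh ((s : ℂ) * Complex.exp ((θ : ℂ) * Complex.I)) 0 / Real.sqrt (uh ((s : ℂ) * Complex.exp ((θ : ℂ) * Complex.I)) 0 ^ 2 + uh ((s : ℂ) * Complex.exp ((θ : ℂ) * Complex.I)) 1 ^ 2))
             Filter.atTop (𝓝 (Real.cos ((σ : ℝ) * θ + c)))) ∧
           (∀ θ : ℝ, Tendsto (fun s : ℝ =>
               uh ((s : ℂ) * Complex.exp ((θ : ℂ) * Complex.I)) 1 / Real.sqrt (uh ((s : ℂ) * Complex.exp ((θ : ℂ) * Complex.I)) 0 ^ 2 + uh ((s : ℂ) * Complex.exp ((θ : ℂ) * Complex.I)) 1 ^ 2))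
             Filter.atTop (𝓝 (Real.sin ((σ : ℝ) * θ + c)))))) ∧
        (∀ w : ℂ → punctured p,
          ((∀ z : ℂ, z ≠ 0 → ContMDiffAt 𝓘(ℝ, ℂ) (𝓡 4) ∞ w z) ∧
          IsJHolomorphicOn (𝓡 4) J' w {z : ℂ | z ≠ 0} ∧
          (∀ z : ℂ, z ≠ 0 → ∀ i : Fin 2, w z ∉ φ' i '' {y : E4 | y 0 ^ 2 + y 1 ^ 2 = 1 ∧ y 2 = 0 ∧ y 3 = 0}) ∧
          MeasureTheory.Integrable (fun z : ℂ =>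
            sf' (w z) ![mfderiv 𝓘(ℝ, ℂ) (𝓡 4) w z (1 : ℂ), mfderiv 𝓘(ℝ, ℂ) (𝓡 4) w z Complex.I])) →
          (∃ (uh : ℂ → E4) (r₁ c : ℝ) (σ : ℤ), 0 < r₁ ∧ σ ≠ 0 ∧
            (∀ z : ℂ, z ≠ 0 → ‖z‖ < r₁ →
              uh z ∈ {y : E4 | (Real.sqrt (y 0 ^ 2 + y 1 ^ 2) - 1) ^ 2 + y 2 ^ 2 + y 3 ^ 2 < δ' ^ 2} ∧ w z = φ' 0 (uh z)) ∧
            Tendsto (fun z : ℂ => ((Real.sqrt (uh z 0 ^ 2 + uh z 1 ^ 2) - 1) ^ 2 + uh z 2 ^ 2 + uh z 3 ^ 2)) (𝓝[≠] 0) (𝓝 0) ∧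
            (∀ θ : ℝ, Tendsto (fun s : ℝ =>
                uh ((s : ℂ) * Complex.exp ((θ : ℂ) * Complex.I)) 0 / Real.sqrt (uh ((s : ℂ) * Complex.exp ((θ : ℂ) * Complex.I)) 0 ^ 2 + uh ((s : ℂ) * Complex.exp ((θ : ℂ) * Complex.I)) 1 ^ 2))
              (𝓝[>] 0) (𝓝 (Real.cos ((σ : ℝ) * θ + c)))) ∧
            (∀ θ : ℝ, Tendsto (fun s : ℝ =>
                uh ((s : ℂ) * Complex.exp ((θ : ℂ) * Complex.I)) 1 / Real.sqrt (uh ((s : ℂ) * Complex.exp ((θ : ℂ) * Complex.I)) 0 ^ 2 + uh ((s : ℂ) * Complex.exp ((θ : ℂ) * Complex.I)) 1 ^ 2))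
              (𝓝[>] 0) (𝓝 (Real.sin ((σ : ℝ) * θ + c))))) →
          ∃ a : ℂ, a ≠ 0 ∧ ∀ z : ℂ, z ≠ 0 → w z = u (a * z)) ∧
        (∀ w : ℂ → punctured p,
          ((∀ z : ℂ, z ≠ 0 → ContMDiffAt 𝓘(ℝ, ℂ) (𝓡 4) ∞ w z) ∧
          IsJHolomorphicOn (𝓡 4) J' w {z : ℂ | z ≠ 0} ∧
          (∀ z : ℂ, z ≠ 0 → ∀ i : Fin 2, w z ∉ φ' i '' {y : E4 | y 0 ^ 2 + y 1 ^ 2 = 1 ∧ y 2 = 0 ∧ y 3 = 0}) ∧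
          MeasureTheory.Integrable (fun z : ℂ =>
            sf' (w z) ![mfderiv 𝓘(ℝ, ℂ) (𝓡 4) w z (1 : ℂ), mfderiv 𝓘(ℝ, ℂ) (𝓡 4) w z Complex.I])) →
          (∃ (uh : ℂ → E4) (R₂ c : ℝ) (σ : ℤ), 0 < R₂ ∧ σ ≠ 0 ∧
            (∀ z : ℂ, R₂ < ‖z‖ →
              uh z ∈ {y : E4 | (Real.sqrt (y 0 ^ 2 + y 1 ^ 2) - 1) ^ 2 + y 2 ^ 2 + y 3 ^ 2 < δ' ^ 2} ∧ w z = φ' 1 (uh z)) ∧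
            Tendsto (fun z : ℂ => ((Real.sqrt (uh z 0 ^ 2 + uh z 1 ^ 2) - 1) ^ 2 + uh z 2 ^ 2 + uh z 3 ^ 2)) (Filter.cocompact ℂ) (𝓝 0) ∧
            (∀ θ : ℝ, Tendsto (fun s : ℝ =>
                uh ((s : ℂ) * Complex.exp ((θ : ℂ) * Complex.I)) 0 / Real.sqrt (uh ((s : ℂ) * Complex.exp ((θ : ℂ) * Complex.I)) 0 ^ 2 + uh ((s : ℂ) * Complex.exp ((θ : ℂ) * Complex.I)) 1 ^ 2))
              Filter.atTop (𝓝 (Real.cos ((σ : ℝ) * θ + c)))) ∧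
            (∀ θ : ℝ, Tendsto (fun s : ℝ =>
                uh ((s : ℂ) * Complex.exp ((θ : ℂ) * Complex.I)) 1 / Real.sqrt (uh ((s : ℂ) * Complex.exp ((θ : ℂ) * Complex.I)) 0 ^ 2 + uh ((s : ℂ) * Complex.exp ((θ : ℂ) * Complex.I)) 1 ^ 2))
              Filter.atTop (𝓝 (Real.sin ((σ : ℝ) * θ + c))))) →
          ∃ a : ℂ, a ≠ 0 ∧ ∀ z : ℂ, z ≠ 0 → w z = u (a * z)) := by
  sorry

set_option maxHeartbeats 2000000 in
set_option maxRecDepth 8000 in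
/-- **Stub 4 — `Cancellation`, APEX B: Taubes' cancellation of a pair of zero circles along a
GLOBALLY UNIQUE finite-energy cylinder, relative to the standard end (XL / open since Taubes 1998).**
Let `(ω, φ)` be as in Stub 1 and `J` admissible as in Stub 2 on `Σ ∖ p`; let `u` be a finite-energy
`J`-cylinder from `Z₁` (degree-one end at `0`) to `Z₂` (degree-one end at `∞`) which is the UNIQUE
finite-energy punctured plane incident to `Z₁` at `0` and the unique one incident to `Z₂` at `∞`
(uniqueness quantifies over ends of every non-zero degree), and which stays off the punctured
`ε`-ball (Stub 5).  Then `Σ ∖ p` carries a smooth closed non-degenerate `2`-form standard on some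
punctured chart-ball: `IsSymplecticStandardNearPoint p ε' sf` — the two circles cancel.  This is
Taubes' 1998 suggestion ("the existence of certain pseudoholomorphic cylinders between zero-circles may
be used to cancel the zero-circles, analogous to the Morse cancellation lemma", recorded in Gerig 2021
p. 4) stated with the GLOBAL hypothesis that the Morse prototype needs (Laudenbach, arXiv:1307.2545,
Theorem p. 2: unique connecting orbit + control of all other orbits leaving the upper point; Milnor,
h-cobordism Thm 5.4) — NOT the germ-local "model cylinder + normal form ⇒ symplectic replacement near
it", which is FALSE (`S¹ × M_{5₂}`: Cruxes/Target/NEGATIVE-local-cancellation-is-dead.md; there the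
Novikov count `2 − 3t + 2t²` of connecting orbits shows uniqueness fails, consistently with this
stub).  Dictionary: `ω ↔ dt∧df + ⋆df`, zero circles `↔ S¹ × crit f`, `J`-cylinders `↔ S¹ ×` gradient
lines (Gerig GT 26 (2022) §1.5, Hutchings–Lee), cancellation `↔` Morse–Smale cancellation; the output
form may differ from `ω` on a large compact set (as `f'` differs from `f`), only the end is kept.  Why
it might fail: no proof technique is known — Moser/Gray/Honda normal forms cannot consume a uniqueness
hypothesis, and the uniqueness assumed here (punctured planes with a wrapped end) might have to be
widened to Taubes' whole class of finite-energy subvarieties touching `Z` (1998 Thm 1.8: cones,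
half-discs) before a deformation argument closes.
[cite: arXiv:1905.10938, p. 4] [cite: arXiv:1307.2545, Theorem] [cite: arXiv:1809.03405, §1.5]
[cite: arXiv:math/9901142, Thm 1.8] -/
theorem stub_cancellation :
    ∀ (S : HomotopySphere 4) (p : S.carrier) (ε δ : ℝ) (sf : MForm (𝓡 4) (punctured p) ℝ 2) (φ : (Fin 2 → E4 → punctured p)) (J : ∀ x : punctured p, TangentSpace (𝓡 4) x →L[ℝ] TangentSpace (𝓡 4) x)
      (u : ℂ → punctured p),
      (0 < ε ∧ Metric.closedBall (extChartAt (𝓡 4) p p) ε ⊆ (extChartAt (𝓡 4) p).target ∧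
      0 < δ ∧ δ < 1 ∧
      IsSmoothForm sf ∧ IsClosedForm sf ∧ IsStandardOnBall p ε sf ∧
      (∀ i : Fin 2,
        Set.InjOn (φ i) {y : E4 | (Real.sqrt (y 0 ^ 2 + y 1 ^ 2) - 1) ^ 2 + y 2 ^ 2 + y 3 ^ 2 < δ ^ 2} ∧
        ContMDiffOn 𝓘(ℝ, E4) (𝓡 4) ∞ (φ i) {y : E4 | (Real.sqrt (y 0 ^ 2 + y 1 ^ 2) - 1) ^ 2 + y 2 ^ 2 + y 3 ^ 2 < δ ^ 2} ∧
        (∀ q ∈ {y : E4 | (Real.sqrt (y 0 ^ 2 + y 1 ^ 2) - 1) ^ 2 + y 2 ^ 2 + y 3 ^ 2 < δ ^ 2},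
          Function.Injective (mfderiv 𝓘(ℝ, E4) (𝓡 4) (φ i) q)) ∧
        (∀ q ∈ {y : E4 | (Real.sqrt (y 0 ^ 2 + y 1 ^ 2) - 1) ^ 2 + y 2 ^ 2 + y 3 ^ 2 < δ ^ 2},
          ¬ InPuncturedChartBall p ε (φ i q)) ∧
        (∀ q ∈ {y : E4 | (Real.sqrt (y 0 ^ 2 + y 1 ^ 2) - 1) ^ 2 + y 2 ^ 2 + y 3 ^ 2 < δ ^ 2},
          ∀ a b : E4,
          sf (φ i q) ![mfderiv 𝓘(ℝ, E4) (𝓡 4) (φ i) q a, mfderiv 𝓘(ℝ, E4) (𝓡 4) (φ i) q b] =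
            ((q 0 * a 1 - q 1 * a 0) / (q 0 ^ 2 + q 1 ^ 2)) * ((Real.sqrt (q 0 ^ 2 + q 1 ^ 2) - 1) * ((q 0 * b 0 + q 1 * b 1) / Real.sqrt (q 0 ^ 2 + q 1 ^ 2)) + q 2 * b 2 - 2 * q 3 * b 3)
            - ((q 0 * b 1 - q 1 * b 0) / (q 0 ^ 2 + q 1 ^ 2)) * ((Real.sqrt (q 0 ^ 2 + q 1 ^ 2) - 1) * ((q 0 * a 0 + q 1 * a 1) / Real.sqrt (q 0 ^ 2 + q 1 ^ 2)) + q 2 * a 2 - 2 * q 3 * a 3)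
            + (Real.sqrt (q 0 ^ 2 + q 1 ^ 2) - 1) * (a 2 * b 3 - b 2 * a 3)
            - q 2 * (((q 0 * a 0 + q 1 * a 1) / Real.sqrt (q 0 ^ 2 + q 1 ^ 2)) * b 3 - ((q 0 * b 0 + q 1 * b 1) / Real.sqrt (q 0 ^ 2 + q 1 ^ 2)) * a 3)
            - 2 * q 3 * (((q 0 * a 0 + q 1 * a 1) / Real.sqrt (q 0 ^ 2 + q 1 ^ 2)) * b 2 - ((q 0 * b 0 + q 1 * b 1) / Real.sqrt (q 0 ^ 2 + q 1 ^ 2)) * a 2))) ∧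
      Disjoint (φ 0 '' {y : E4 | (Real.sqrt (y 0 ^ 2 + y 1 ^ 2) - 1) ^ 2 + y 2 ^ 2 + y 3 ^ 2 < δ ^ 2})
        (φ 1 '' {y : E4 | (Real.sqrt (y 0 ^ 2 + y 1 ^ 2) - 1) ^ 2 + y 2 ^ 2 + y 3 ^ 2 < δ ^ 2}) ∧
      (∀ x : punctured p, (∀ i : Fin 2, x ∉ φ i '' {y : E4 | y 0 ^ 2 + y 1 ^ 2 = 1 ∧ y 2 = 0 ∧ y 3 = 0}) →
        ∀ v : TangentSpace (𝓡 4) x, v ≠ 0 → ∃ v' : TangentSpace (𝓡 4) x, sf x ![v, v'] ≠ 0)) →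
      ((∀ x : punctured p, (∀ i : Fin 2, x ∉ φ i '' {y : E4 | y 0 ^ 2 + y 1 ^ 2 = 1 ∧ y 2 = 0 ∧ y 3 = 0}) →
        ∀ v : TangentSpace (𝓡 4) x, J x (J x v) = -v) ∧
      (∀ x₀ : punctured p, (∀ i : Fin 2, x₀ ∉ φ i '' {y : E4 | y 0 ^ 2 + y 1 ^ 2 = 1 ∧ y 2 = 0 ∧ y 3 = 0}) →
        ContMDiffAt (𝓡 4) 𝓘(ℝ, E4 →L[ℝ] E4) ∞
          (inTangentCoordinates (𝓡 4) (𝓡 4) (id : punctured p → punctured p) id (fun x => J x) x₀) x₀) ∧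
      (∀ x : punctured p, (∀ i : Fin 2, x ∉ φ i '' {y : E4 | y 0 ^ 2 + y 1 ^ 2 = 1 ∧ y 2 = 0 ∧ y 3 = 0}) →
        ∀ v : TangentSpace (𝓡 4) x, v ≠ 0 → 0 < sf x ![v, J x v]) ∧
      (∀ x : punctured p, InPuncturedChartBall p ε x → ∀ (v : TangentSpace (𝓡 4) x) (b : E4),
        inner ℝ (fderiv ℝ inversion (extChartAt (𝓡 4) p x.1 - extChartAt (𝓡 4) p p)
          (mfderiv (𝓡 4) 𝓘(ℝ, E4) (fun z : punctured p => extChartAt (𝓡 4) p z.1) x (J x v))) b =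
        stdSymplecticForm (fderiv ℝ inversion (extChartAt (𝓡 4) p x.1 - extChartAt (𝓡 4) p p)
          (mfderiv (𝓡 4) 𝓘(ℝ, E4) (fun z : punctured p => extChartAt (𝓡 4) p z.1) x v)) b) ∧
      (∀ i : Fin 2, ∀ q ∈ {y : E4 | (Real.sqrt (y 0 ^ 2 + y 1 ^ 2) - 1) ^ 2 + y 2 ^ 2 + y 3 ^ 2 < δ ^ 2},
        ¬ (q 0 ^ 2 + q 1 ^ 2 = 1 ∧ q 2 = 0 ∧ q 3 = 0) → ∀ a b : E4,
        sf (φ i q) ![mfderiv 𝓘(ℝ, E4) (𝓡 4) (φ i) q a, J (φ i q) (mfderiv 𝓘(ℝ, E4) (𝓡 4) (φ i) q b)] =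
          Real.sqrt ((Real.sqrt (q 0 ^ 2 + q 1 ^ 2) - 1) ^ 2 + q 2 ^ 2 + 4 * q 3 ^ 2) *
          (((q 0 * a 1 - q 1 * a 0) / (q 0 ^ 2 + q 1 ^ 2)) * ((q 0 * b 1 - q 1 * b 0) / (q 0 ^ 2 + q 1 ^ 2)) + ((q 0 * a 0 + q 1 * a 1) / Real.sqrt (q 0 ^ 2 + q 1 ^ 2)) * ((q 0 * b 0 + q 1 * b 1) / Real.sqrt (q 0 ^ 2 + q 1 ^ 2)) + a 2 * b 2 + a 3 * b 3))) →
(((∀ z : ℂ, z ≠ 0 → ContMDiffAt 𝓘(ℝ, ℂ) (𝓡 4) ∞ u z) ∧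
       IsJHolomorphicOn (𝓡 4) J u {z : ℂ | z ≠ 0} ∧
       (∀ z : ℂ, z ≠ 0 → ∀ i : Fin 2, u z ∉ φ i '' {y : E4 | y 0 ^ 2 + y 1 ^ 2 = 1 ∧ y 2 = 0 ∧ y 3 = 0}) ∧
       MeasureTheory.Integrable (fun z : ℂ =>
         sf (u z) ![mfderiv 𝓘(ℝ, ℂ) (𝓡 4) u z (1 : ℂ), mfderiv 𝓘(ℝ, ℂ) (𝓡 4) u z Complex.I])) ∧
       (∃ (uh : ℂ → E4) (r₁ c : ℝ) (σ : ℤ), 0 < r₁ ∧ (σ = 1 ∨ σ = -1) ∧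
         (∀ z : ℂ, z ≠ 0 → ‖z‖ < r₁ →
           uh z ∈ {y : E4 | (Real.sqrt (y 0 ^ 2 + y 1 ^ 2) - 1) ^ 2 + y 2 ^ 2 + y 3 ^ 2 < δ ^ 2} ∧ u z = φ 0 (uh z)) ∧
         Tendsto (fun z : ℂ => ((Real.sqrt (uh z 0 ^ 2 + uh z 1 ^ 2) - 1) ^ 2 + uh z 2 ^ 2 + uh z 3 ^ 2)) (𝓝[≠] 0) (𝓝 0) ∧
         (∀ θ : ℝ, Tendsto (fun s : ℝ =>
             uh ((s : ℂ) * Complex.exp ((θ : ℂ) * Complex.I)) 0 / Real.sqrt (uh ((s : ℂ) * Complex.exp ((θ : ℂ) * Complex.I)) 0 ^ 2 + uh ((s : ℂ) * Complex.exp ((θ : ℂ) * Complex.I)) 1 ^ 2))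
           (𝓝[>] 0) (𝓝 (Real.cos ((σ : ℝ) * θ + c)))) ∧
         (∀ θ : ℝ, Tendsto (fun s : ℝ =>
             uh ((s : ℂ) * Complex.exp ((θ : ℂ) * Complex.I)) 1 / Real.sqrt (uh ((s : ℂ) * Complex.exp ((θ : ℂ) * Complex.I)) 0 ^ 2 + uh ((s : ℂ) * Complex.exp ((θ : ℂ) * Complex.I)) 1 ^ 2))
           (𝓝[>] 0) (𝓝 (Real.sin ((σ : ℝ) * θ + c))))) ∧
       (∃ (uh : ℂ → E4) (R₂ c : ℝ) (σ : ℤ), 0 < R₂ ∧ (σ = 1 ∨ σ = -1) ∧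
         (∀ z : ℂ, R₂ < ‖z‖ →
           uh z ∈ {y : E4 | (Real.sqrt (y 0 ^ 2 + y 1 ^ 2) - 1) ^ 2 + y 2 ^ 2 + y 3 ^ 2 < δ ^ 2} ∧ u z = φ 1 (uh z)) ∧
         Tendsto (fun z : ℂ => ((Real.sqrt (uh z 0 ^ 2 + uh z 1 ^ 2) - 1) ^ 2 + uh z 2 ^ 2 + uh z 3 ^ 2)) (Filter.cocompact ℂ) (𝓝 0) ∧
         (∀ θ : ℝ, Tendsto (fun s : ℝ =>
             uh ((s : ℂ) * Complex.exp ((θ : ℂ) * Complex.I)) 0 / Real.sqrt (uh ((s : ℂ) * Complex.exp ((θ : ℂ) * Complex.I)) 0 ^ 2 + uh ((s : ℂ) * Complex.exp ((θ : ℂ) * Complex.I)) 1 ^ 2))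
           Filter.atTop (𝓝 (Real.cos ((σ : ℝ) * θ + c)))) ∧
         (∀ θ : ℝ, Tendsto (fun s : ℝ =>
             uh ((s : ℂ) * Complex.exp ((θ : ℂ) * Complex.I)) 1 / Real.sqrt (uh ((s : ℂ) * Complex.exp ((θ : ℂ) * Complex.I)) 0 ^ 2 + uh ((s : ℂ) * Complex.exp ((θ : ℂ) * Complex.I)) 1 ^ 2))
           Filter.atTop (𝓝 (Real.sin ((σ : ℝ) * θ + c)))))) →
      (∀ w : ℂ → punctured p,
        ((∀ z : ℂ, z ≠ 0 → ContMDiffAt 𝓘(ℝ, ℂ) (𝓡 4) ∞ w z) ∧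
        IsJHolomorphicOn (𝓡 4) J w {z : ℂ | z ≠ 0} ∧
        (∀ z : ℂ, z ≠ 0 → ∀ i : Fin 2, w z ∉ φ i '' {y : E4 | y 0 ^ 2 + y 1 ^ 2 = 1 ∧ y 2 = 0 ∧ y 3 = 0}) ∧
        MeasureTheory.Integrable (fun z : ℂ =>
          sf (w z) ![mfderiv 𝓘(ℝ, ℂ) (𝓡 4) w z (1 : ℂ), mfderiv 𝓘(ℝ, ℂ) (𝓡 4) w z Complex.I])) →
        (∃ (uh : ℂ → E4) (r₁ c : ℝ) (σ : ℤ), 0 < r₁ ∧ σ ≠ 0 ∧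
          (∀ z : ℂ, z ≠ 0 → ‖z‖ < r₁ →
            uh z ∈ {y : E4 | (Real.sqrt (y 0 ^ 2 + y 1 ^ 2) - 1) ^ 2 + y 2 ^ 2 + y 3 ^ 2 < δ ^ 2} ∧ w z = φ 0 (uh z)) ∧
          Tendsto (fun z : ℂ => ((Real.sqrt (uh z 0 ^ 2 + uh z 1 ^ 2) - 1) ^ 2 + uh z 2 ^ 2 + uh z 3 ^ 2)) (𝓝[≠] 0) (𝓝 0) ∧
          (∀ θ : ℝ, Tendsto (fun s : ℝ =>
              uh ((s : ℂ) * Complex.exp ((θ : ℂ) * Complex.I)) 0 / Real.sqrt (uh ((s : ℂ) * Complex.exp ((θ : ℂ) * Complex.I)) 0 ^ 2 + uh ((s : ℂ) * Complex.exp ((θ : ℂ) * Complex.I)) 1 ^ 2))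
            (𝓝[>] 0) (𝓝 (Real.cos ((σ : ℝ) * θ + c)))) ∧
          (∀ θ : ℝ, Tendsto (fun s : ℝ =>
              uh ((s : ℂ) * Complex.exp ((θ : ℂ) * Complex.I)) 1 / Real.sqrt (uh ((s : ℂ) * Complex.exp ((θ : ℂ) * Complex.I)) 0 ^ 2 + uh ((s : ℂ) * Complex.exp ((θ : ℂ) * Complex.I)) 1 ^ 2))
            (𝓝[>] 0) (𝓝 (Real.sin ((σ : ℝ) * θ + c))))) →
        ∃ a : ℂ, a ≠ 0 ∧ ∀ z : ℂ, z ≠ 0 → w z = u (a * z)) →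
      (∀ w : ℂ → punctured p,
        ((∀ z : ℂ, z ≠ 0 → ContMDiffAt 𝓘(ℝ, ℂ) (𝓡 4) ∞ w z) ∧
        IsJHolomorphicOn (𝓡 4) J w {z : ℂ | z ≠ 0} ∧
        (∀ z : ℂ, z ≠ 0 → ∀ i : Fin 2, w z ∉ φ i '' {y : E4 | y 0 ^ 2 + y 1 ^ 2 = 1 ∧ y 2 = 0 ∧ y 3 = 0}) ∧
        MeasureTheory.Integrable (fun z : ℂ =>
          sf (w z) ![mfderiv 𝓘(ℝ, ℂ) (𝓡 4) w z (1 : ℂ), mfderiv 𝓘(ℝ, ℂ) (𝓡 4) w z Complex.I])) →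
        (∃ (uh : ℂ → E4) (R₂ c : ℝ) (σ : ℤ), 0 < R₂ ∧ σ ≠ 0 ∧
          (∀ z : ℂ, R₂ < ‖z‖ →
            uh z ∈ {y : E4 | (Real.sqrt (y 0 ^ 2 + y 1 ^ 2) - 1) ^ 2 + y 2 ^ 2 + y 3 ^ 2 < δ ^ 2} ∧ w z = φ 1 (uh z)) ∧
          Tendsto (fun z : ℂ => ((Real.sqrt (uh z 0 ^ 2 + uh z 1 ^ 2) - 1) ^ 2 + uh z 2 ^ 2 + uh z 3 ^ 2)) (Filter.cocompact ℂ) (𝓝 0) ∧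
          (∀ θ : ℝ, Tendsto (fun s : ℝ =>
              uh ((s : ℂ) * Complex.exp ((θ : ℂ) * Complex.I)) 0 / Real.sqrt (uh ((s : ℂ) * Complex.exp ((θ : ℂ) * Complex.I)) 0 ^ 2 + uh ((s : ℂ) * Complex.exp ((θ : ℂ) * Complex.I)) 1 ^ 2))
            Filter.atTop (𝓝 (Real.cos ((σ : ℝ) * θ + c)))) ∧
          (∀ θ : ℝ, Tendsto (fun s : ℝ =>
              uh ((s : ℂ) * Complex.exp ((θ : ℂ) * Complex.I)) 1 / Real.sqrt (uh ((s : ℂ) * Complex.exp ((θ : ℂ) * Complex.I)) 0 ^ 2 + uh ((s : ℂ) * Complex.exp ((θ : ℂ) * Complex.I)) 1 ^ 2))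
            Filter.atTop (𝓝 (Real.sin ((σ : ℝ) * θ + c))))) →
        ∃ a : ℂ, a ≠ 0 ∧ ∀ z : ℂ, z ≠ 0 → w z = u (a * z)) →
      (∀ z : ℂ, z ≠ 0 → ¬ InPuncturedChartBall p ε (u z)) →
      ∃ (ε' : ℝ) (sf : MForm (𝓡 4) (punctured p) ℝ 2), IsSymplecticStandardNearPoint p ε' sf := by
  sorry

/-- **Stub 5 — `EndConfinement`: the maximum principle at the standard end (L; provable now).**  Let
`J` be standard on the punctured `ε`-chart-ball of `Σ ∖ p` (closed ball inside the chart target), and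
let `u : ℂ → Σ ∖ p` be `C^∞` and `J`-holomorphic on `ℂ ∖ 0`.  If `u` is off the `ε`-ball for
`0 < ‖z‖ < r₁` and for `‖z‖ > R₂` (its two ends are elsewhere — for the cylinders of Stubs 2–4 this is
read off the tube clauses, as the composition below does), then `u` is off the `ε`-ball everywhere on
`ℂ ∖ 0`.  Proof plan: `Ω₁ := {z ≠ 0 | u z ∈ B_ε}` is open with compact closure in the annulus
`r₁ ≤ ‖z‖ ≤ R₂`; in the complex flat coordinates `y = ι(e(u z) − e p) ∈ ℂ²` (`WitnessCharge` Defs: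
`Ycoord`) the map is HOLOMORPHIC on `Ω₁` (standardness of `J`: `Dι∘De ∘ J = i ∘ Dι∘De`, cf.
`isJHolomorphicOn_mulByI_iff_differentiableOn`) with `‖y‖ > 1/ε` inside and `‖y‖ = 1/ε` on `∂Ω₁`
(boundary points stay in `e⁻¹(closedBall)`, a compact subset of the chart source); the maximum modulus
principle for holomorphic maps into the Hilbert space `ℂ²`
(`Complex.eqOn_of_isPreconnected_of_isMaxOn_norm`) on a component of `Ω₁` gives the contradiction, and a
non-empty open subset of `ℂ` has no compact component.  Leans on: tree `inversion` API
(`StandardEnd`), `Ycoord`/`realify`/`J0` (`SullivanDualWitnessChargeDefs`), `JHolomorphicOn`; Mathlib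
max modulus.  Why it might fail: it does not (classical); formal size is the chart bookkeeping. [folklore] -/
theorem stub_endConfinement :
    ∀ (S : HomotopySphere 4) (p : S.carrier) (ε : ℝ) (J : ∀ x : punctured p, TangentSpace (𝓡 4) x →L[ℝ] TangentSpace (𝓡 4) x)
      (u : ℂ → punctured p) (r₁ R₂ : ℝ),
      0 < ε → Metric.closedBall (extChartAt (𝓡 4) p p) ε ⊆ (extChartAt (𝓡 4) p).target →
      (∀ x : punctured p, InPuncturedChartBall p ε x → ∀ (v : TangentSpace (𝓡 4) x) (b : E4),
        inner ℝ (fderiv ℝ inversion (extChartAt (𝓡 4) p x.1 - extChartAt (𝓡 4) p p)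
          (mfderiv (𝓡 4) 𝓘(ℝ, E4) (fun z : punctured p => extChartAt (𝓡 4) p z.1) x (J x v))) b =
        stdSymplecticForm (fderiv ℝ inversion (extChartAt (𝓡 4) p x.1 - extChartAt (𝓡 4) p p)
          (mfderiv (𝓡 4) 𝓘(ℝ, E4) (fun z : punctured p => extChartAt (𝓡 4) p z.1) x v)) b) →
      (∀ z : ℂ, z ≠ 0 → ContMDiffAt 𝓘(ℝ, ℂ) (𝓡 4) ∞ u z) →
      IsJHolomorphicOn (𝓡 4) J u {z : ℂ | z ≠ 0} →
      0 < r₁ →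
      (∀ z : ℂ, z ≠ 0 → ‖z‖ < r₁ → ¬ InPuncturedChartBall p ε (u z)) →
      (∀ z : ℂ, R₂ < ‖z‖ → ¬ InPuncturedChartBall p ε (u z)) →
      ∀ z : ℂ, z ≠ 0 → ¬ InPuncturedChartBall p ε (u z) := by
  sorry

/-! ## The composition (kernel-checked; no `sorry` of its own) -/

/-- **The line concludes the crux BY NAME.**  Stub 1 (near-symplectic normal form: two untwisted
model circles, standard end) → Stub 2 (admissible `J` + SW-forced half-cylinders) → Stub 3 (APEX A:
selection of a uniquely spanning cylinder) → Stub 5 (its ends are in the tubes, the tubes are off the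
`ε'`-ball, so the whole cylinder is off the ball) → Stub 4 (APEX B: cancellation rel the standard end)
→ door 3 of the crux, the landed `SullivanDual.target_of_sympcapThesisV2` (p119400: a symplectic form
standard near `p` on every `Σ ∖ p` gives `Target`).  Pure logic. -/
theorem Target_of : Summit.SmoothPoincare4.SmoothPoincare4.Theses.SullivanDual.Target := by
  refine Summit.SmoothPoincare4.SmoothPoincare4.Theorems.SullivanDual.target_of_sympcapThesisV2 ?_
  intro S p
  obtain ⟨ε, δ, sf, φ, hNF⟩ := stub_nearSymplecticNormalForm S p
  obtain ⟨J, hJ, hhalf⟩ := stub_spanningHalfCylinders S p ε δ sf φ hNF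
  obtain ⟨ε', δ', sf', φ', J', u, hNF', hJ', hu, hU0, hUi⟩ :=
    stub_cylinderSelection S p ε δ sf φ hNF J hJ hhalf
  -- Stub 5: the selected cylinder stays off the punctured `ε'`-ball
  have hconf : ∀ z : ℂ, z ≠ 0 → ¬ InPuncturedChartBall p ε' (u z) := by
    obtain ⟨hε', hball', -, -, -, -, -, htube, -, -⟩ := hNF'
    obtain ⟨-, -, -, hstd', -⟩ := hJ'
    obtain ⟨⟨hsm, hhol, -, -⟩, h0, hinf⟩ := hu
    obtain ⟨uh, r₁, c, σ, hr₁, -, hloc, -, -, -⟩ := h0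
    obtain ⟨uh₂, R₂, c₂, σ₂, hR₂, -, hloc₂, -, -, -⟩ := hinf
    refine stub_endConfinement S p ε' J' u r₁ R₂ hε' hball' hstd' hsm hhol hr₁ ?_ ?_
    · intro z hz hzr
      obtain ⟨hT, heq⟩ := hloc z hz hzr
      rw [heq]
      exact (htube 0).2.2.2.1 _ hT
    · intro z hz
      obtain ⟨hT, heq⟩ := hloc₂ z hz
      rw [heq]
      exact (htube 1).2.2.2.1 _ hT
  -- Stub 4: cancellation rel the standard end
  exact stub_cancellation S p ε' δ' sf' φ' J' u hNF' hJ' hu hU0 hUi hconf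

/-! ## Sanity (kernel-checked): the inline model is the Taubes model, and it is untwisted

Two tiny checks that the inline conventions are not vacuous by accident: at the core point
`q = (1, 0, 0, 0)` of the model solid torus the coframe is `dt = dy₁`, `dx = dy₀`; (i) the model form
VANISHES on the core circle (it is a zero circle), (ii) one step off the core in the `x`-direction,
`q = (1 + x, 0, 0, 0)`, the model form is `x (dt∧dx + dy∧dz)`, non-degenerate for `x ≠ 0` with
`ω_T(e_t, e_x) = x` — the transverse, linear vanishing of a near-symplectic zero (the lone axis
`∂_{y₃}` being constant along the core, the circle is untwisted). -/

/-- The model form vanishes at the core point `(1,0,0,0)`. -/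
theorem omegaT_core (a b : E4) :
    (let q : E4 := WithLp.toLp 2 ![1, 0, 0, 0]
     ((q 0 * a 1 - q 1 * a 0) / (q 0 ^ 2 + q 1 ^ 2)) * ((Real.sqrt (q 0 ^ 2 + q 1 ^ 2) - 1) * ((q 0 * b 0 + q 1 * b 1) / Real.sqrt (q 0 ^ 2 + q 1 ^ 2)) + q 2 * b 2 - 2 * q 3 * b 3)
     - ((q 0 * b 1 - q 1 * b 0) / (q 0 ^ 2 + q 1 ^ 2)) * ((Real.sqrt (q 0 ^ 2 + q 1 ^ 2) - 1) * ((q 0 * a 0 + q 1 * a 1) / Real.sqrt (q 0 ^ 2 + q 1 ^ 2)) + q 2 * a 2 - 2 * q 3 * a 3)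
     + (Real.sqrt (q 0 ^ 2 + q 1 ^ 2) - 1) * (a 2 * b 3 - b 2 * a 3)
     - q 2 * (((q 0 * a 0 + q 1 * a 1) / Real.sqrt (q 0 ^ 2 + q 1 ^ 2)) * b 3 - ((q 0 * b 0 + q 1 * b 1) / Real.sqrt (q 0 ^ 2 + q 1 ^ 2)) * a 3)
     - 2 * q 3 * (((q 0 * a 0 + q 1 * a 1) / Real.sqrt (q 0 ^ 2 + q 1 ^ 2)) * b 2 - ((q 0 * b 0 + q 1 * b 1) / Real.sqrt (q 0 ^ 2 + q 1 ^ 2)) * a 2)) = 0 := by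
  simp
  
/-- Off the core, at `q = (1 + x, 0, 0, 0)` (`0 < 1 + x`), on the pair `a = e_t' = (0, 1 + x, 0, 0)`
(so `dt(a) = 1`, `dx(a) = 0`) and `b = e_x = (1, 0, 0, 0)` (`dt(b) = 0`, `dx(b) = 1`) the model form
evaluates to `ω_T(e_t', e_x) = x`: linear, transverse vanishing across the core circle (a
near-symplectic zero), with the normal coordinate `x = √(y₀²+y₁²) − 1`. -/
theorem omegaT_transverse (x : ℝ) (hx : 0 < 1 + x) :
    (let q : E4 := WithLp.toLp 2 ![1 + x, 0, 0, 0]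
     let a : E4 := WithLp.toLp 2 ![0, 1 + x, 0, 0]
     let b : E4 := WithLp.toLp 2 ![1, 0, 0, 0]
     ((q 0 * a 1 - q 1 * a 0) / (q 0 ^ 2 + q 1 ^ 2)) * ((Real.sqrt (q 0 ^ 2 + q 1 ^ 2) - 1) * ((q 0 * b 0 + q 1 * b 1) / Real.sqrt (q 0 ^ 2 + q 1 ^ 2)) + q 2 * b 2 - 2 * q 3 * b 3)
     - ((q 0 * b 1 - q 1 * b 0) / (q 0 ^ 2 + q 1 ^ 2)) * ((Real.sqrt (q 0 ^ 2 + q 1 ^ 2) - 1) * ((q 0 * a 0 + q 1 * a 1) / Real.sqrt (q 0 ^ 2 + q 1 ^ 2)) + q 2 * a 2 - 2 * q 3 * a 3)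
     + (Real.sqrt (q 0 ^ 2 + q 1 ^ 2) - 1) * (a 2 * b 3 - b 2 * a 3)
     - q 2 * (((q 0 * a 0 + q 1 * a 1) / Real.sqrt (q 0 ^ 2 + q 1 ^ 2)) * b 3 - ((q 0 * b 0 + q 1 * b 1) / Real.sqrt (q 0 ^ 2 + q 1 ^ 2)) * a 3)
     - 2 * q 3 * (((q 0 * a 0 + q 1 * a 1) / Real.sqrt (q 0 ^ 2 + q 1 ^ 2)) * b 2 - ((q 0 * b 0 + q 1 * b 1) / Real.sqrt (q 0 ^ 2 + q 1 ^ 2)) * a 2)) = x := by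
  have h1 : Real.sqrt ((1 + x) ^ 2) = 1 + x := Real.sqrt_sq hx.le
  have hne : (1 + x) ≠ 0 := hx.ne'
  simp [h1]
  field_simp

end Summit.SmoothPoincare4.SmoothPoincare4.Cruxes.Target.LastTwistedCircle

end
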